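import Summits.BirchSwinnertonDyer.BirchSwinnertonDyer.Theorems.BiquadraticEisensteinDescentHeegnerTwistCouplingInSupplySylvesterTwistThreeAdicCubes
import Literature.NumberTheory.QuadraticForms.PadicSquares
import HarnessLib

set_option linter.dupNamespace false -- `Summit.BirchSwinnertonDyer.BirchSwinnertonDyer.Theorems.…` (summit = sub, D-0017)
set_option autoImplicit false

/-!
# Crux `HeegnerTwistCouplingInSupply` (stmt-BirchSwinnertonDyer-21381) — programme «TWISTED 3-ISOGENY DESCENT», file P1b (sequel of `…SylvesterTwistThreeAdicCubes`):
# the `3`-adic image of the `φ`-descent map `(X, Y) ↦ Y + B` on `Y² = X³ + B²` is TRIVIAL when `B = t³ S`, `S ∈ ℤ₃`,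
# `S² ≡ 7 (mod 9)` — the twisted Sylvester family `y² = x³ − 2p²`, `p ≡ 8 (mod 9)`

Route `BiquadraticEisensteinDescent` (cell `pub/bsd-wall`, width seat `bsd-wall-cm-bed-w4` g32; `--supports` 21381, helper).
The programme (memo `Cruxes/HeegnerTwistCouplingInSupply/TWISTED-DESCENT-PROGRAMME-w4g32.md`) discharges the `3`-descent
hypothesis `hDescU` of `…SylvesterCornerSqrtMinusTwo` for the quadratic twists `W_p^{(−8)} ≅ y² = x³ − 2p²`
(`p ≡ 17, 35 (mod 72)`) of Sylvester's curves `y² + py = x³` by a genuine `3`-isogeny descent in the tree's cohomological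
currency. This file is its LOCAL INPUT AT THE PRIME `3`. On the `φ̂`-side of the descent the Kummer field is `K = ℚ(√−2)`,
the prime `3 = (1 + √−2)(1 − √−2)` SPLITS, `K_𝔮 = ℚ₃`, and the partner curve is, over `ℚ₃ ∋ s = √−2`, the curve
`Y² = X³ + B²` with `B = 27 p s = 3³ · (p s)`, `S = p s`, `S² = −2p² ≡ −2 ≡ 7 (mod 9)` (as `p ≡ −1 (mod 9)`). The descent
map is the tree's `MordellDescent.cubicDescent B : (X, Y) ↦ Y + B` (`O ↦ 1`, `(0, −B) ↦ (2B)²`; Literature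
`MordellCurvePhiDescentHom`, `phiDescent c = cubicDescent (9c)`).

★ `cubicDescent_eq_cube_of_sq_toZModPow_eq_seven` / `cubicDescentClass_eq_one_of_sq_toZModPow_eq_seven`. Let `S ∈ ℤ₃`
with `S² ≡ 7 (mod 9)` (i.e. `S ≡ ±4 (mod 9)`), `t ∈ ℚ₃ˣ`, `B = t³ S`. Then for EVERY point `P` of `Y² = X³ + B²` over `ℚ₃`
the descent value `cubicDescent B P` is a non-zero cube of `ℚ₃`: the local image at `3` is trivial, so the local condition at
`𝔮 ∣ 3` of the `φ̂`-Selmer group reads «`u` is a `3`-adic cube» — which is where the certificate `9 ∤ x` (`p = x² + 2y²`) of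
the programme bites (`(x + y s)/(x − y s) ≡ ±1 (mod 9)` iff `9 ∣ xy`).

Proof (elementary `3`-adic analysis, no curve theory). After rescaling, `y² = x³ + S²` over `ℚ₃` and the value is `y + S`
(resp. the cube `(2S)²`: `2S ≡ ±1 (mod 9)`, and units `≡ ±1 (mod 9)` are cubes in `ℤ₃` — Hensel at precision `27`, tree
`UniversalToricDescentTwinDecLocusCubeTest.exists_cube_root_of_toZModPow_two`).
* `x ∈ ℤ₃ˣ` is IMPOSSIBLE: unit cubes are `≡ ±1 (mod 9)`, so `x³ + S² ≡ ±1 + 7 ∈ {8, 6} (mod 9)`, not a square mod `9`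
  (`ZMod 9` check `no_unit_point_mod_nine`);
* `3 ∣ x`: `(y + S)(y − S) = x³ ≡ 0 (mod 27)` with `(y + S) − (y − S) = 2S` a unit, so exactly one factor is a unit,
  `≡ ±2S ≡ ±1 (mod 9)`, hence a cube `z³`, and the other factor is `x³ / z³`;
* `‖x‖ > 1`: `‖y‖² = ‖x‖³`, `x = x₀/3^{2m}`, `y = y₀/3^{3m}` with units `x₀, y₀`, `y₀² ≡ x₀³ (mod 3⁶)`, so `y₀² ≡ ±1`,
  `y₀ ≡ ±1 (mod 9)` and `y + S = (y₀ + 3^{3m}S)/3^{3m}` with `y₀ + 3^{3m} S ≡ y₀ ≡ ±1 (mod 9)` a cube.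

Also: the Sylvester instance `S = p·s`, `p ≡ 8 (mod 9)`, `s² = −2` (`sq_toZModPow_eq_seven_of_sylvester`,
`cubicDescentClass_eq_one_sylvester`), and `√−2 ∈ ℤ₃` (`exists_padicInt_three_sq_eq_neg_two`).

HONEST FRAMING: a local lemma of a support-layer programme on ONE CM family (measure zero in «all CM `W`»); the crux
(residual C⁺), its registered stubs, `hDescU` itself and BSD are untouched; nothing is closed by this file. THEOREMS ONLY
(no `def`, no named fact, no sorry). Supports stmt-BirchSwinnertonDyer-21381.
[cite: CohenPazuki2009, §4 (local images at p = 3)] [cite: SilvermanAEC2009, Prop. X.4.9 and Exercise 10.19]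
-/

noncomputable section

open scoped Classical

open Polynomial

namespace Summit.BirchSwinnertonDyer.BirchSwinnertonDyer.Theorems.SylvesterTwistDescent

open Literature.NumberTheory.EllipticCurves Literature.NumberTheory.EllipticCurves.MordellDescent
open Summit.BirchSwinnertonDyer.BirchSwinnertonDyer.Theorems.UniversalToricDescentTwinDecLocusCubeTest
  (norm_eq_one_of_toZModPow_two exists_cube_root_of_toZModPow_two zmod9_unit_cube)

section Hyp

variable {S : ℤ_[3]} (hS : PadicInt.toZModPow 2 (S ^ 2) = 7)
include hS

/-! ## §5 Non-integral points: `‖x‖ > 1` -/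

/-- **Non-integral points: `y + S` is a non-zero cube of `ℚ₃`.** If `‖x‖ > 1` and `y² = x³ + S²` then
`‖y‖² = ‖x‖³`, `x = x₀ 3^{−2m}`, `y = y₀ 3^{−3m}` (`m ≥ 1`, units `x₀, y₀`), `y₀² ≡ x₀³ ≡ ±1`, so
`y₀ ≡ ±1 (mod 9)` and `y + S = (y₀ + 3^{3m}S)·3^{−3m}` is a cube. [cite: CohenPazuki2009, §4] -/
theorem exists_add_S_eq_cube_of_one_lt_norm {x y : ℚ_[3]} (hx : 1 < ‖x‖)
    (h : y ^ 2 = x ^ 3 + (S : ℚ_[3]) ^ 2) : ∃ w : ℚ_[3], w ≠ 0 ∧ y + S = w ^ 3 := by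
  have hS1 := norm_S_eq_one hS
  have hx0 : x ≠ 0 := by rintro rfl; norm_num at hx
  have hx3 : ‖x ^ 3‖ = ‖x‖ ^ 3 := norm_pow x 3
  have hgt : 1 < ‖x ^ 3‖ := by
    rw [hx3]; exact one_lt_pow₀ hx three_ne_zero
  have hS2 : ‖(S : ℚ_[3]) ^ 2‖ ≤ 1 := by
    rw [norm_pow, PadicInt.padic_norm_e_of_padicInt, hS1, one_pow]
  have hsum : ‖x ^ 3 + (S : ℚ_[3]) ^ 2‖ = ‖x‖ ^ 3 := by
    rw [Padic.add_eq_max_of_ne (by linarith), max_eq_left (by linarith), hx3]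
  have hy2 : ‖y‖ ^ 2 = ‖x‖ ^ 3 := by rw [← norm_pow, h, hsum]
  have hy0 : y ≠ 0 := by
    rintro rfl
    rw [norm_zero, zero_pow two_ne_zero] at hy2
    have : (0 : ℝ) < ‖x‖ ^ 3 := by positivity
    linarith
  have hy1 : 1 < ‖y‖ := by
    by_contra hle
    push Not at hle
    have : ‖y‖ ^ 2 ≤ 1 := pow_le_one₀ (norm_nonneg _) hle
    have : (1 : ℝ) < ‖x‖ ^ 3 := one_lt_pow₀ hx three_ne_zero
    linarith
  -- valuations: `v(x) = −2m`, `v(y) = −3m`, `m ≥ 1`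
  have hval := two_mul_valuation_eq_of_sq_eq hx0 hy0 hy2
  have hvx : x.valuation < 0 := by
    have := Padic.norm_eq_zpow_neg_valuation hx0
    rw [this] at hx
    have h1 : (1 : ℝ) = ((3 : ℕ) : ℝ) ^ (0 : ℤ) := by norm_num
    rw [h1] at hx
    have := (zpow_lt_zpow_iff_right₀ (by norm_num : (1 : ℝ) < ((3 : ℕ) : ℝ))).mp hx
    linarith
  obtain ⟨m, hm⟩ : ∃ m : ℕ, x.valuation = -(2 * (m : ℤ)) ∧ y.valuation = -(3 * (m : ℤ)) := by
    have heven : 2 ∣ x.valuation := by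
      have : (2 : ℤ) ∣ 3 * x.valuation := ⟨y.valuation, by linarith⟩
      exact (Int.prime_two.dvd_mul.mp this).resolve_left (by norm_num)
    obtain ⟨k, hk⟩ := heven
    refine ⟨(-k).toNat, ?_, ?_⟩
    · have : (((-k).toNat : ℕ) : ℤ) = -k := Int.toNat_of_nonneg (by linarith)
      rw [this]; linarith
    · have : (((-k).toNat : ℕ) : ℤ) = -k := Int.toNat_of_nonneg (by linarith)
      rw [this]; linarith
  have hm1 : 1 ≤ m := by
    by_contra h0
    push Not at h0
    have : m = 0 := by omega
    rw [this] at hm; simp at hm; linarith [hm.1]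
  -- the rescaled units
  set q : ℚ_[3] := ((3 : ℕ) : ℚ_[3]) with hq
  have hq0 : q ≠ 0 := by rw [hq]; norm_num
  have hqn : ‖q‖ = ((3 : ℕ) : ℝ) ^ (-1 : ℤ) := by
    rw [hq, Padic.norm_eq_zpow_neg_valuation hq0, Padic.valuation_natCast, padicValNat_self]; norm_num
  have hx0n : ‖x * q ^ (2 * m)‖ = 1 := by
    rw [norm_mul, norm_pow, hqn, Padic.norm_eq_zpow_neg_valuation hx0, hm.1, ← zpow_natCast, ← zpow_mul,
      ← zpow_add₀ (by norm_num)]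
    push_cast
    ring_nf
    simp
  have hy0n : ‖y * q ^ (3 * m)‖ = 1 := by
    rw [norm_mul, norm_pow, hqn, Padic.norm_eq_zpow_neg_valuation hy0, hm.2, ← zpow_natCast, ← zpow_mul,
      ← zpow_add₀ (by norm_num)]
    push_cast
    ring_nf
    simp
  set X₀ : ℤ_[3] := ⟨x * q ^ (2 * m), hx0n.le⟩ with hX₀
  set Y₀ : ℤ_[3] := ⟨y * q ^ (3 * m), hy0n.le⟩ with hY₀
  have hX₀n : ‖X₀‖ = 1 := hx0n
  have hY₀n : ‖Y₀‖ = 1 := hy0n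
  -- the rescaled equation in `ℤ₃`
  have heq : Y₀ ^ 2 = X₀ ^ 3 + (((3 : ℕ) : ℤ_[3]) ^ (3 * m) * S) ^ 2 := by
    apply Subtype.coe_injective
    show (y * q ^ (3 * m)) ^ 2 = (x * q ^ (2 * m)) ^ 3 + (q ^ (3 * m) * (S : ℚ_[3])) ^ 2
    have e1 : (y * q ^ (3 * m)) ^ 2 = y ^ 2 * q ^ (6 * m) := by ring
    have e2 : (x * q ^ (2 * m)) ^ 3 + (q ^ (3 * m) * (S : ℚ_[3])) ^ 2 = (x ^ 3 + (S : ℚ_[3]) ^ 2) * q ^ (6 * m) := by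
      ring
    rw [e1, e2, h]
  -- reduce mod `9`: `Ȳ₀² = X̄₀³`, both units, so `Ȳ₀ = ±1`
  have h9 := congrArg (PadicInt.toZModPow 2) heq
  have h3m : PadicInt.toZModPow 2 (((3 : ℕ) : ℤ_[3]) ^ (3 * m)) = 0 := by
    rw [map_pow, map_natCast]
    exact three_pow_eq_zero_zmod_nine (by omega)
  rw [map_pow, map_add, map_pow, mul_pow, map_mul, map_pow, h3m, zero_pow two_ne_zero, zero_mul, add_zero] at h9
  obtain ⟨cX, hcX⟩ := (PadicInt.isUnit_iff.mpr hX₀n).exists_right_inv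
  obtain ⟨cY, hcY⟩ := (PadicInt.isUnit_iff.mpr hY₀n).exists_right_inv
  have hcX9 := congrArg (PadicInt.toZModPow 2) hcX
  have hcY9 := congrArg (PadicInt.toZModPow 2) hcY
  rw [map_mul, map_one] at hcX9 hcY9
  have hX3 := zmod9_unit_cube _ _ hcX9
  have hY1 : PadicInt.toZModPow 2 Y₀ = 1 ∨ PadicInt.toZModPow 2 Y₀ = -1 :=
    eq_or_of_sq_eq_or _ (by rw [h9]; exact hX3)
  -- `Y₀ + 3^{3m} S ≡ Y₀ ≡ ±1 (mod 9)` is a cube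
  have hmod : PadicInt.toZModPow 2 (Y₀ + ((3 : ℕ) : ℤ_[3]) ^ (3 * m) * S) = 1 ∨
      PadicInt.toZModPow 2 (Y₀ + ((3 : ℕ) : ℤ_[3]) ^ (3 * m) * S) = -1 := by
    rw [map_add, map_mul, h3m, zero_mul, add_zero]; exact hY1
  obtain ⟨w, hw0, hw⟩ := exists_ne_zero_coe_eq_pow_three_of_toZModPow hmod
  refine ⟨w / q ^ m, div_ne_zero hw0 (pow_ne_zero _ hq0), ?_⟩
  have hwq : ((Y₀ + ((3 : ℕ) : ℤ_[3]) ^ (3 * m) * S : ℤ_[3]) : ℚ_[3]) = (y + S) * q ^ (3 * m) := by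
    show y * q ^ (3 * m) + q ^ (3 * m) * (S : ℚ_[3]) = (y + S) * q ^ (3 * m)
    ring
  rw [div_pow, eq_div_iff (pow_ne_zero _ (pow_ne_zero _ hq0)), ← hw, hwq]
  ring

/-! ## §6 All points: `y ± S` is zero or a non-zero cube -/

/-- **Every `ℚ₃`-point of `y² = x³ + S²` (`S² ≡ 7 (mod 9)`) has `y + S = 0` or `y + S` a non-zero cube.**
[cite: CohenPazuki2009, §4] -/
theorem exists_add_S_eq_cube {x y : ℚ_[3]} (h : y ^ 2 = x ^ 3 + (S : ℚ_[3]) ^ 2) (hne : y + S ≠ 0) :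
    ∃ w : ℚ_[3], w ≠ 0 ∧ y + S = w ^ 3 := by
  by_cases hx : 1 < ‖x‖
  · exact exists_add_S_eq_cube_of_one_lt_norm hS hx h
  · push Not at hx
    have hS1 := norm_S_eq_one hS
    -- `y` is integral too
    have hy : ‖y‖ ≤ 1 := by
      have h2 : ‖y‖ ^ 2 ≤ 1 := by
        rw [← norm_pow, h]
        refine le_trans (Padic.nonarchimedean _ _) (max_le ?_ ?_)
        · rw [norm_pow]; exact pow_le_one₀ (norm_nonneg _) hx
        · rw [norm_pow, PadicInt.padic_norm_e_of_padicInt, hS1, one_pow]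
      by_contra hlt
      push Not at hlt
      have : 1 < ‖y‖ ^ 2 := one_lt_pow₀ hlt two_ne_zero
      linarith
    set X : ℤ_[3] := ⟨x, hx⟩ with hX
    set Y : ℤ_[3] := ⟨y, hy⟩ with hY
    have heq : Y ^ 2 = X ^ 3 + S ^ 2 := by
      apply Subtype.coe_injective
      change y ^ 2 = x ^ 3 + ((S ^ 2 : ℤ_[3]) : ℚ_[3])
      push_cast; exact h
    exact exists_add_S_eq_cube_of_integral hS heq hne

/-- **… and `y − S = 0` or `y − S` a non-zero cube** (the same statement for `−S`). [cite: CohenPazuki2009, §4] -/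
theorem exists_sub_S_eq_cube {x y : ℚ_[3]} (h : y ^ 2 = x ^ 3 + (S : ℚ_[3]) ^ 2) (hne : y - S ≠ 0) :
    ∃ w : ℚ_[3], w ≠ 0 ∧ y - S = w ^ 3 := by
  have h' : y ^ 2 = x ^ 3 + (((-S : ℤ_[3])) : ℚ_[3]) ^ 2 := by push_cast; rw [neg_sq]; exact h
  have hne' : y + ((-S : ℤ_[3]) : ℚ_[3]) ≠ 0 := by push_cast; rwa [← sub_eq_add_neg]
  obtain ⟨w, hw0, hw⟩ := exists_add_S_eq_cube (hyp_neg hS) h' hne'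
  exact ⟨w, hw0, by rw [← hw]; push_cast; ring⟩

end Hyp

/-! ## §7 The descent map `cubicDescent B`, `B = t³ S`: the `3`-adic image is trivial -/

section Descent

variable {S : ℤ_[3]} (hS : PadicInt.toZModPow 2 (S ^ 2) = 7) {t : ℚ_[3]} (ht : t ≠ 0)
include hS ht

/-- **THE `3`-ADIC IMAGE OF `cubicDescent B` IS TRIVIAL** for `B = t³ S`, `S ∈ ℤ₃`, `S² ≡ 7 (mod 9)`: every value
`cubicDescent B P`, `P` a `ℚ₃`-point of `W = (Y² = X³ + B²)`, is a non-zero cube (`O ↦ 1 = 1³`, `(0, −B) ↦ (2B)² =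
(t² (2S)^{2/3})³`, `(X, Y) ↦ Y + B = t³ (y + S)` with `y = Y/t³`). [cite: CohenPazuki2009, §4] -/
theorem cubicDescent_eq_cube_of_sq_toZModPow_eq_seven {W : WeierstrassCurve ℚ_[3]}
    (hW : W = mordellCurve ((t ^ 3 * S) ^ 2)) (P : W.toAffine.Point) :
    ∃ w : ℚ_[3], w ≠ 0 ∧ cubicDescent W (t ^ 3 * S) P = w ^ 3 := by
  rcases P with _ | ⟨X, Y, hXY⟩
  · exact ⟨1, one_ne_zero, by rw [← WeierstrassCurve.Affine.Point.zero_def, cubicDescent_zero, one_pow]⟩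
  · have hE : Y ^ 2 = X ^ 3 + (t ^ 3 * S) ^ 2 := by
      have := hXY.left
      rw [hW, mordellCurve_equation_iff] at this
      exact this
    by_cases hY : Y = -(t ^ 3 * S)
    · -- `(2B)² = t⁶ (2S)² = (t² w²)³` with `2S = w³`
      rw [cubicDescent_some_of_eq _ hXY hY]
      obtain ⟨w, hw0, hw⟩ := exists_two_mul_S_eq_cube hS
      refine ⟨t ^ 2 * w ^ 2, mul_ne_zero (pow_ne_zero 2 ht) (pow_ne_zero 2 hw0), ?_⟩
      have : (2 * (t ^ 3 * (S : ℚ_[3]))) = t ^ 3 * (2 * S) := by ring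
      rw [this, hw]; ring
    · rw [cubicDescent_some_of_ne _ hXY hY]
      -- rescale: `y = Y/t³`, `x = X/t²`
      set x : ℚ_[3] := X / t ^ 2 with hx
      set y : ℚ_[3] := Y / t ^ 3 with hy
      have ht2 : t ^ 2 ≠ 0 := pow_ne_zero 2 ht
      have ht3 : t ^ 3 ≠ 0 := pow_ne_zero 3 ht
      have hX : X = x * t ^ 2 := by rw [hx, div_mul_cancel₀ _ ht2]
      have hY' : Y = y * t ^ 3 := by rw [hy, div_mul_cancel₀ _ ht3]
      have heq : y ^ 2 = x ^ 3 + (S : ℚ_[3]) ^ 2 := by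
        have ht6 : t ^ 6 ≠ 0 := pow_ne_zero 6 ht
        apply mul_right_cancel₀ ht6
        have : Y ^ 2 = (x ^ 3 + (S : ℚ_[3]) ^ 2) * t ^ 6 := by rw [hE, hX]; ring
        rw [← this, hY']; ring
      have hne : y + S ≠ 0 := by
        intro h0
        apply hY
        rw [hY', show y = -(S : ℚ_[3]) by linear_combination h0]; ring
      obtain ⟨w, hw0, hw⟩ := exists_add_S_eq_cube hS heq hne
      refine ⟨t * w, mul_ne_zero ht hw0, ?_⟩
      rw [hY', mul_pow, ← hw]; ring

/-- **Class form: `cubicDescentClass B P = 1` in `ℚ₃ˣ/ℚ₃ˣ³`** for every `ℚ₃`-point `P` (`B = t³ S` as above).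
[cite: CohenPazuki2009, §4] -/
theorem cubicDescentClass_eq_one_of_sq_toZModPow_eq_seven {W : WeierstrassCurve ℚ_[3]}
    (hW : W = mordellCurve ((t ^ 3 * S) ^ 2)) (P : W.toAffine.Point) :
    cubicDescentClass W (t ^ 3 * S) P = 1 := by
  obtain ⟨w, hw0, hw⟩ := cubicDescent_eq_cube_of_sq_toZModPow_eq_seven hS ht hW P
  have hne : cubicDescent W (t ^ 3 * S) P ≠ 0 := by rw [hw]; exact pow_ne_zero 3 hw0
  rw [cubicDescentClass, cubeClass_eq_one_iff hne]
  exact ⟨w, hw0, hw⟩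

end Descent

/-! ## §8 The Sylvester instance `S = p·√−2`, `p ≡ 8 (mod 9)` -/

section Sylvester

/-- **The twisted Sylvester datum satisfies the hypothesis**: for `p ≡ 8 (mod 9)` and `s ∈ ℤ₃` with `s² = −2`,
`S = p s` has `S² = −2p² ≡ −2 ≡ 7 (mod 9)`. [folklore] -/
theorem sq_toZModPow_eq_seven_of_sylvester {p : ℕ} (hp : p % 9 = 8) {s : ℤ_[3]} (hs : s ^ 2 = -2) :
    PadicInt.toZModPow 2 (((p : ℤ_[3]) * s) ^ 2) = 7 := by
  rw [mul_pow, map_mul, map_pow, map_natCast, hs, map_neg, map_ofNat]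
  have hp9 : ((p : ℕ) : ZMod (3 ^ 2)) = 8 := by
    have : ((p : ℕ) : ZMod 9) = ((8 : ℕ) : ZMod 9) := (ZMod.natCast_eq_natCast_iff' p 8 9).mpr (by rw [hp])
    exact this
  rw [hp9]; decide

/-- **`√−2 ∈ ℤ₃`**: there is `s ∈ ℤ₃` with `s² = −2` (`−2 ≡ 1 (mod 3)`, Hensel; tree
`padicInt_isSquare_of_toZMod_eq_one`). [folklore] -/
theorem exists_padicInt_three_sq_eq_neg_two : ∃ s : ℤ_[3], s ^ 2 = -2 := by
  have h : PadicInt.toZMod (-2 : ℤ_[3]) = 1 := by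
    rw [map_neg, map_ofNat]; decide
  obtain ⟨s, hs⟩ := Literature.NumberTheory.QuadraticForms.padicInt_isSquare_of_toZMod_eq_one (p := 3)
    (by norm_num) h
  exact ⟨s, by rw [sq]; exact hs.symm⟩

/-- **Sylvester form of the triviality**: for `p ≡ 8 (mod 9)`, `s² = −2` in `ℤ₃`, `t ∈ ℚ₃ˣ` and
`B = t³ · p s`, every `ℚ₃`-point `P` of `Y² = X³ + B²` has `cubicDescentClass B P = 1`. For the programme's
partner curve `Y² = X³ − 1458 p²` one takes `t = 3` (`B = 27 p s`, `B² = −1458 p²`). [cite: CohenPazuki2009, §4] -/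
theorem cubicDescentClass_eq_one_sylvester {p : ℕ} (hp : p % 9 = 8) {s : ℤ_[3]} (hs : s ^ 2 = -2)
    {t : ℚ_[3]} (ht : t ≠ 0) {W : WeierstrassCurve ℚ_[3]}
    (hW : W = mordellCurve ((t ^ 3 * (((p : ℤ_[3]) * s : ℤ_[3]) : ℚ_[3])) ^ 2)) (P : W.toAffine.Point) :
    cubicDescentClass W (t ^ 3 * (((p : ℤ_[3]) * s : ℤ_[3]) : ℚ_[3])) P = 1 :=
  cubicDescentClass_eq_one_of_sq_toZModPow_eq_seven (sq_toZModPow_eq_seven_of_sylvester hp hs) ht hW P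

end Sylvester

end Summit.BirchSwinnertonDyer.BirchSwinnertonDyer.Theorems.SylvesterTwistDescent

end
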